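import Summits.CriticalPhenomena.PercolationContinuityZ3.Theorems.Transplant.SitePeelTools
import HarnessLib

/-!
# SITE percolation: (S5D)_site — hence (S5)_site — from the site conditioned slack hierarchy (site THEOREM 2, peeling)
# (lane `prim-bschramm`, class C1a; site twin of `Theorems/PercNearOneGluingNoHeavyLowerTailCSHPeel.lean`)

builds on p205010 (kernel theorem, internal audit signed; external expert review pending).

Verbatim transplant of the peeling induction (memo PROOF-S5-ALL-R §4; CHAIN-READ §4.1) to site percolation with vertex
weights: `SiteCSH.s5dMargin_nonneg_of_siteCSH` — for non-degenerate weights and observers off the relay set, site CSH for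
every (owner, avoided set, decoy list) implies the site (S5D) margin `≥ 0` for every relay set, compatible injective rank,
decoy list and monotone `F`; and the socket **`SiteCSH.siteSurplusTransfer_of_siteCSHAll`**: `SiteCSHAll →` the site
surplus-transfer inequality (S5)_site for NON-DEGENERATE weights (`0 < q v < 1`), i.e. the hypothesis shape of
`SiteGen.siteGen_of_siteSurplusTransfer` at such weights.  (The closure over degenerate weights, bond (C1)
`AdditiveGluingSurplusClosure.lean`, is the remaining routine step; not in this file.)
Support file (`--supports stmt-CriticalPhenomena-4575 --as helper`); sorry-free.
[cite: KozmaNitzan2024, Conj. 4 (p. 32)] [cite: VandenbergHaggstromKahn2005, §2.1 (pp. 9–13)]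
-/

noncomputable section

namespace Summit.CriticalPhenomena.PercolationContinuityZ3.Theorems.Transplant

namespace SiteCSH

open MeasureTheory Set Literature.Probability.LatticeModels Literature.Probability.Percolation
open Summit.CriticalPhenomena.PercolationContinuityZ3.Theorems.CSH (slForm cshMarg cshMarg_nil cshMarg_cons cshMarg_add
  cshMarg_smul cshMarg_sub cshMarg_congr slForm_zero)
open Summit.CriticalPhenomena.PercolationContinuityZ3.Theorems.SiteTransplant (siteConn mem_siteConn)
open SiteGen (mem_siteConn_iff_mem_siteCluster)
open scoped Classical

variable {n : ℕ} {Γ : SimpleGraph (Fin n)}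

/-- **Site THEOREM 2 (peeling): (S5D)_site from site CSH.**  Verbatim `CSH.s5dMargin_nonneg_of_csh` with the site data
(`SiteCSH.*`, `SitePeelTools`). [cite: KozmaNitzan2024, Conj. 4 (p. 32)] -/
theorem s5dMargin_nonneg_of_siteCSH (q : Fin n → unitInterval) (hq : ∀ v, 0 < q v ∧ q v < 1) (o v : Fin n)
    (hCSH : ∀ (x : Fin n) (Y : Finset (Fin n)) (D : List (Fin n)),
      x ∉ Y → o ≠ x → v ≠ x → o ∉ Y → v ∉ Y → D.Nodup → (∀ d ∈ D, d ≠ x ∧ d ∉ Y ∧ d ≠ o ∧ d ≠ v) →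
      SiteCSHHolds Γ q x (↑Y : Set (Fin n)) D o v) :
    ∀ (T : Finset (Fin n)) (r : Fin n → ℕ) (D : List (Fin n)) (F : Set (Fin n) → ℝ),
      (∀ S S' : Set (Fin n), S ⊆ S' → F S ≤ F S') → Set.InjOn r ↑T →
      (∀ a ∈ T, ∀ a' ∈ T, r a < r a' →
        ∫ ω, F (siteCluster Γ ω a) ∂(prodBernoulli q) ≤ ∫ ω, F (siteCluster Γ ω a') ∂(prodBernoulli q)) →
      o ∉ T → v ∉ T → D.Nodup → (∀ d ∈ D, d ∉ T ∧ d ≠ o ∧ d ≠ v) →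
      0 ≤ s5dMargin Γ q T r D o v F := by
  have main : ∀ (N : ℕ) (T : Finset (Fin n)) (r : Fin n → ℕ) (D : List (Fin n)) (F : Set (Fin n) → ℝ), T.card = N →
      (∀ S S' : Set (Fin n), S ⊆ S' → F S ≤ F S') → Set.InjOn r ↑T →
      (∀ a ∈ T, ∀ a' ∈ T, r a < r a' →
        ∫ ω, F (siteCluster Γ ω a) ∂(prodBernoulli q) ≤ ∫ ω, F (siteCluster Γ ω a') ∂(prodBernoulli q)) →
      o ∉ T → v ∉ T → D.Nodup → (∀ d ∈ D, d ∉ T ∧ d ≠ o ∧ d ≠ v) →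
      0 ≤ s5dMargin Γ q T r D o v F := by
    intro N
    induction N using Nat.strong_induction_on with
    | _ N ih =>
    intro T r D F hN hF hr hcompat hoT hvT hD hDT
    set μ := prodBernoulli q with hμ
    have hmeas : ∀ S : Set (Set (Fin n)), MeasurableSet S := fun _ => MeasurableSet.of_discrete
    have hn := fun (S : Set (Set (Fin n))) => (measureReal_nonneg : 0 ≤ μ.real S)
    rcases T.eq_empty_or_nonempty with hT0 | hne
    · subst hT0
      have h0 : surplus Γ q (∅ : Finset (Fin n)) r F = fun _ => 0 := by
        funext u; simp [surplus]
      rw [s5dMargin, h0]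
      have := slForm_zero (decoyList Γ q (↑(∅ : Finset (Fin n)) : Set (Fin n)) D)
      simp only [cshMarg]
      rw [show (fun _ : Fin n => (0 : ℝ)) = (0 : Fin n → ℝ) from rfl, this]
      simp
    obtain ⟨k, hkT, hkmax⟩ := Finset.exists_max_image T r hne
    set T' : Finset (Fin n) := T.erase k with hT'
    have hTcard : T'.card < N := by
      have hpos : 0 < T.card := Finset.card_pos.2 hne
      rw [hT', Finset.card_erase_of_mem hkT]; omega
    have hT'T : ∀ a ∈ T', a ∈ T := fun a ha => Finset.mem_of_mem_erase ha
    have hkT' : k ∉ T' := Finset.notMem_erase k T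
    have hlt : ∀ a ∈ T', r a < r k := by
      intro a ha
      rcases (hkmax a (hT'T a ha)).lt_or_eq with h | h
      · exact h
      · exact absurd (hr (hT'T a ha) hkT h) (Finset.ne_of_mem_erase ha)
    have hrT' : Set.InjOn r ↑T' := hr.mono (by intro a ha; exact hT'T a ha)
    have hcompatT' : ∀ a ∈ T', ∀ a' ∈ T', r a < r a' →
        ∫ ω, F (siteCluster Γ ω a) ∂μ ≤ ∫ ω, F (siteCluster Γ ω a') ∂μ :=
      fun a ha a' ha' h => hcompat a (hT'T a ha) a' (hT'T a' ha') h
    have hmle : ∀ a ∈ T', ∫ ω, F (siteCluster Γ ω a) ∂μ ≤ ∫ ω, F (siteCluster Γ ω k) ∂μ :=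
      fun a ha => hcompat a (hT'T a ha) k hkT (hlt a ha)
    have hko : o ≠ k := fun h => hoT (h ▸ hkT)
    have hkv : v ≠ k := fun h => hvT (h ▸ hkT)
    have hkD : k ∉ D := fun h => (hDT k h).1 hkT
    set Dk : Set (Set (Fin n)) := {ω : Set (Fin n) | ∀ a ∈ (↑T' : Set (Fin n)), a ∉ siteCluster Γ ω k} with hDk
    set mk : ℝ := ∫ ω, F (siteCluster Γ ω k) ∂μ with hmk
    set κ : ℝ := mk * μ.real Dk - ∫ ω in Dk, F (siteCluster Γ ω k) ∂μ with hκ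
    set L := decoyList Γ q (↑T : Set (Fin n)) D with hL
    set p : ℝ := obsConst Γ q o v ((↑T : Set (Fin n)) ∪ {d | d ∈ D}) with hp
    set ck : Fin n → ℝ := avoidConst Γ q k (↑T' : Set (Fin n)) with hck
    set Tk : Fin n → ℝ := fun u => (∫ ω in Dk ∩ siteConn Γ k u, F (siteCluster Γ ω k) ∂μ) -
      μ.real (Dk ∩ siteConn Γ k u) * mk with hTk
    -- positivity of the conditioning events (non-degenerate weights): the all-closed configuration
    have hempty_Dk : (∅ : Set (Fin n)) ∈ Dk := by
      intro a _ h
      exact h.1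
    have hDkpos : 0 < μ.real Dk := prodBernoulli_real_pos_of_nonempty hq ⟨∅, hempty_Dk⟩
    have hisopos : 0 < μ.real (Dk ∩ {ω | siteCluster Γ ω k = ∅}) :=
      prodBernoulli_real_pos_of_nonempty hq ⟨∅, hempty_Dk,
        Set.eq_empty_of_forall_notMem fun y hy => hy.1⟩
    have hins : insert k (↑T' : Set (Fin n)) = ↑T := by
      rw [hT', Finset.coe_erase, insert_sdiff_singleton, insert_eq_of_mem (Finset.mem_coe.2 hkT)]
    have hset2 : (↑T' : Set (Fin n)) ∪ {d | d ∈ k :: D} = (↑T : Set (Fin n)) ∪ {d | d ∈ D} := by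
      ext a
      simp only [mem_union, Finset.mem_coe, hT', Finset.mem_erase, mem_setOf_eq, List.mem_cons]
      constructor
      · rintro (⟨_, ha⟩ | rfl | ha)
        · exact Or.inl ha
        · exact Or.inl hkT
        · exact Or.inr ha
      · rintro (ha | ha)
        · by_cases hak : a = k
          · exact Or.inr (Or.inl hak)
          · exact Or.inl ⟨hak, ha⟩
        · exact Or.inr (Or.inr ha)
    have hcshMargin : ∀ f : Set (Fin n) → ℝ,
        cshMargin Γ q k (↑T' : Set (Fin n)) D o v f = cshMarg L p o v (covD Γ q k (↑T' : Set (Fin n)) f) := by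
      intro f
      rw [cshMargin, hins]
    have hnext : s5dMargin Γ q T' r (k :: D) o v F =
        cshMarg L p o v (surplus Γ q T' r F) - surplus Γ q T' r F k * cshMarg L p o v ck := by
      rw [s5dMargin, hset2, decoyList, hins, cshMarg_cons]
    -- (1) Lemma P
    have hpeel : surplus Γ q T r F = (surplus Γ q T' r F) + Tk := by
      funext u
      rw [Pi.add_apply, surplus_erase_add q T r F hkT hlt u]
    -- (2) the top-relay term through `covD`
    have hTk_cov : (μ.real Dk) • Tk = covD Γ q k (↑T' : Set (Fin n)) F - (κ * μ.real Dk) • ck := by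
      funext u
      simp only [Pi.smul_apply, Pi.sub_apply, smul_eq_mul]
      have h1 := covD_eq (Γ := Γ) q T' F k u
      have h2 : μ.real (Dk ∩ siteConn Γ k u) = μ.real Dk * ck u := by
        simp only [hck, avoidConst, hDk]
        rw [mul_div_cancel₀ _ (ne_of_gt hDkpos)]
      simp only [hTk, hκ, hmk, hDk] at h1 h2 ⊢
      rw [h1, h2]
      ring
    -- (3) site CSH for the peeled relay, functional `F`
    have hCSHk := hCSH k T' D hkT' hko hkv (fun h => hoT (hT'T o h)) (fun h => hvT (hT'T v h)) hD
      (fun d hd => ⟨fun h => hkD (h ▸ hd), fun h => (hDT d hd).1 (hT'T d h), (hDT d hd).2.1, (hDT d hd).2.2⟩)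
    have h3 : 0 ≤ cshMarg L p o v (covD Γ q k (↑T' : Set (Fin n)) F) := by
      rw [← hcshMargin]
      exact hCSHk F (fun C C' h => hF C C' h)
    -- (4) Lemma AC: `Marg[c_k] ≥ 0` from site CSH applied to `Ψ_iso`
    have h4 : 0 ≤ cshMarg L p o v ck := by
      have hiso := hCSHk psiIsoSite psiIso_mono
      rw [hcshMargin] at hiso
      have hLk : ∀ dc ∈ L, dc.1 ≠ k := fun dc hdc h => hkD (h ▸ mem_decoyList q _ D dc hdc)
      rw [cshMarg_congr L p o v (covD Γ q k (↑T' : Set (Fin n)) psiIsoSite)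
        ((μ.real (Dk ∩ {ω | siteCluster Γ ω k = ∅}) * μ.real Dk) • ck) (fun u => u ≠ k) hLk hko hkv
        (fun u _ => by
          rw [covD_psiIso q T' k u, Pi.smul_apply, smul_eq_mul]
          simp only [hck, avoidConst, hDk]
          rw [mul_assoc, mul_div_cancel₀ _ (ne_of_gt hDkpos)]), cshMarg_smul] at hiso
      exact (mul_nonneg_iff_of_pos_left (mul_pos hisopos hDkpos)).1 hiso
    -- (5) Lemma κ
    have h5 : κ ≤ surplus Γ q T' r F k := kappa_le_surplus q T' r F k hrT' hmle
    -- (6) the next rung by induction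
    have h6 : 0 ≤ s5dMargin Γ q T' r (k :: D) o v F :=
      ih T'.card hTcard T' r (k :: D) F rfl hF hrT' hcompatT' (fun h => hoT (hT'T o h)) (fun h => hvT (hT'T v h))
        (List.nodup_cons.2 ⟨hkD, hD⟩)
        (fun d hd => by
          rcases List.mem_cons.1 hd with rfl | hd
          · exact ⟨hkT', hko.symm, hkv.symm⟩
          · exact ⟨fun h => (hDT d hd).1 (hT'T d h), (hDT d hd).2.1, (hDT d hd).2.2⟩)
    -- (7) assemble
    have hmain : μ.real Dk * s5dMargin Γ q T r D o v F =
        μ.real Dk * cshMarg L p o v (surplus Γ q T' r F) + cshMarg L p o v (covD Γ q k (↑T' : Set (Fin n)) F) -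
          κ * μ.real Dk * cshMarg L p o v ck := by
      have e1 : μ.real Dk * cshMarg L p o v Tk =
          cshMarg L p o v (covD Γ q k (↑T' : Set (Fin n)) F) - κ * μ.real Dk * cshMarg L p o v ck := by
        rw [← cshMarg_smul, hTk_cov, cshMarg_sub, cshMarg_smul]
      rw [s5dMargin, ← hL, ← hp, hpeel, cshMarg_add, mul_add, e1]
      ring
    have hbound : μ.real Dk * s5dMargin Γ q T' r (k :: D) o v F ≤ μ.real Dk * s5dMargin Γ q T r D o v F := by
      rw [hmain, hnext]
      have := mul_le_mul_of_nonneg_right h5 (mul_nonneg hDkpos.le h4)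
      nlinarith [h3, h4, this, hDkpos.le]
    exact le_of_mul_le_mul_left (by linarith [mul_nonneg hDkpos.le h6]) hDkpos
  intro T r D F hF hr hcompat hoT hvT hD hDT
  exact main T.card T r D F rfl hF hr hcompat hoT hvT hD hDT

/-- **The socket: `SiteCSHAll ⇒` (S5)_site at NON-DEGENERATE weights** (all `0 < q v < 1`): the conclusion of
`SiteGen.SiteSurplusTransfer` for such `q` (site THEOREM 2 at `D = []` plus `siteSurplusTransfer_shape_of_s5dMargin_nil`;
the degenerate observers `o = v`, `o ∈ T` hold directly as in the bond socket, and weights `0`/`1` need the closure step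
of bond (C1) — both left to the next file). [cite: KozmaNitzan2024, Conj. 4 (p. 32)] -/
theorem siteSurplusTransfer_nondegenerate_of_siteCSHAll (h : SiteCSHAll) (Γ : SimpleGraph (Fin n))
    (q : Fin n → unitInterval) (hq : ∀ v, 0 < q v ∧ q v < 1) (T : Finset (Fin n)) (o v : Fin n)
    (F : Set (Fin n) → ℝ) (r : Fin n → ℕ) (hoT : o ∉ T) (hvT : v ∉ T) (hov : o ≠ v)
    (hF : ∀ S S' : Set (Fin n), S ⊆ S' → F S ≤ F S') (hr : Set.InjOn r ↑T)
    (hcompat : ∀ a ∈ T, ∀ a' ∈ T, r a < r a' →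
      ∫ ω, F (siteCluster Γ ω a) ∂(prodBernoulli q) ≤ ∫ ω, F (siteCluster Γ ω a') ∂(prodBernoulli q)) :
    (prodBernoulli q).real ({ω : Set (Fin n) | ∀ a ∈ (↑T : Set (Fin n)), a ∉ siteCluster Γ ω v} ∩ siteConn Γ o v) *
        surplus Γ q T r F v ≤
      (prodBernoulli q).real {ω : Set (Fin n) | ∀ a ∈ (↑T : Set (Fin n)), a ∉ siteCluster Γ ω v} * surplus Γ q T r F o := by
  have hpos : 0 < (prodBernoulli q).real {ω : Set (Fin n) | ∀ a ∈ (↑T : Set (Fin n)), a ∉ siteCluster Γ ω v} :=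
    prodBernoulli_real_pos_of_nonempty hq ⟨∅, fun a _ h => h.1⟩
  refine siteSurplusTransfer_shape_of_s5dMargin_nil q T r o v F hpos ?_
  exact s5dMargin_nonneg_of_siteCSH (Γ := Γ) q hq o v (fun x Y D hxY hox hvx hoY hvY hD hdis =>
    h n Γ q hq o v x Y D hov hxY hox hvx hoY hvY hD hdis) T r [] F hF hr hcompat hoT hvT List.nodup_nil
    (fun _ hd => absurd hd List.not_mem_nil)

end SiteCSH

end Summit.CriticalPhenomena.PercolationContinuityZ3.Theorems.Transplant
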